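import Summits.AtomisticToContinuum.Crystallization.Theorems.FrustratedLawDichotomyTwoShellRigidityFccWalk
import Summits.AtomisticToContinuum.Crystallization.Theorems.FrustratedLawDichotomyTwoShellRigidityHcpWalk
import Summits.AtomisticToContinuum.Crystallization.Theorems.FrustratedLawDichotomyTwoShellRigidityOctaCellAt

/-!
# FrustratedLawDichotomy · two-shell rigidity — lens-5's piece `R = CoarseCappedRigidity K θ` PROVED (K = 4796, every 0 < θ ≤ 1/100)

Assembly of the hand lane beneath `M = CappedRigidity` (cut `M ⟸ R ∧ L`, `FrustratedLawDichotomyTwoShellRigidityCells`, lens-5 g30):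
`R ⟸ Extraction ∧ TetraCell ∧ OctaCell ∧ FrameAssembly` with `Extraction` (p820807), `TetraCellAt 11` (p821511), `OctaCellAt 18` (p822087)
and now `FrameAssemblyAt 4796 18` for both kissing patterns (`…FccWalk`, `…HcpWalk`: seed square + eight `placement_step`s below
`θ = 1/2200`, trivial bound above):

* `cellLemmas_holds : CellLemmas 4796 18`, ★ `coarseCappedRigidity_holds : 0 < θ → θ ≤ 1/100 → CoarseCappedRigidity 4796 θ`,
  `uniformCoarseCappedRigidity_holds : UniformCoarseCappedRigidity 4796`;
* `cappedRigidity_of_basinCertificate : BasinCertificate 4796 θ η → CappedRigidity θ η` — M from the certificate ALONE;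
* by name: `aperiodicFrustratedLawGap_of_basinCertificate` (crux of item 27623 ⟸ `MuEquilibriumDoor ∧ ChargedEnergyGap ∧ G(1/100) ∧ P(1/100) ∧
  BasinCertificate 4796 (1/100) (1/20)`), `aperiodicFrustratedLawGap_dial` (certificate-free for `θ < 1/95920`: `MuEquilibriumDoor ∧ PriceTol θ ∧ G θ ∧ P θ`),
  and the door-free `NoFrustratedPeriodicMinimiser` (item 26654) siblings.
CAVEAT OF RECORD: `K = 4796` is a-priori localisation only (ℓ¹ sequential placement; first-order truth `K ≈ 3.95`, census KR18); at the
literal `θ = 1/100` the remaining geometric input `BasinCertificate 4796 (1/100) (1/20)` is a GLOBAL certificate (census lane).  No `sorry`, no defs.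
-/

noncomputable section

namespace Summit.AtomisticToContinuum.Crystallization.Theorems.FrustratedLawDichotomyTwoShellRigidityCoarse

open Literature.Geometry.DiscreteGeometry
open Summit.AtomisticToContinuum.Crystallization.Theorems.FrustratedLawDichotomyTwoShellRigidityCut
  (LinkClassification CapForcing CappedRigidity)
open Summit.AtomisticToContinuum.Crystallization.Theorems.FrustratedLawDichotomyTwoShellRigidityCells
open Summit.AtomisticToContinuum.Crystallization.Theorems.FrustratedLawDichotomyTwoShellRigidityOctaCellAt
open Summit.AtomisticToContinuum.Crystallization.Theorems.FrustratedLawDichotomyTwoShellRigidityFccWalk (frameAssemblyAt_fcc)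
open Summit.AtomisticToContinuum.Crystallization.Theorems.FrustratedLawDichotomyTwoShellRigidityHcpWalk (frameAssemblyAt_hcp)

/-- **`CellLemmas 4796 18`**: all three cell pieces of lens-5's split of R, both patterns. [folklore] -/
theorem cellLemmas_holds : CellLemmas 4796 18 := cellLemmas_of_frameAssembly le_rfl frameAssemblyAt_fcc frameAssemblyAt_hcp

/-- ★ **R PROVED: `CoarseCappedRigidity 4796 θ` for every `0 < θ ≤ 1/100`.** [folklore] -/
theorem coarseCappedRigidity_holds {θ : ℝ} (hθ0 : 0 < θ) (hθ1 : θ ≤ 1 / 100) : CoarseCappedRigidity 4796 θ :=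
  coarseCappedRigidity_of_frameAssembly le_rfl hθ0 hθ1 frameAssemblyAt_fcc frameAssemblyAt_hcp

/-- **R uniformly on the dial**: `UniformCoarseCappedRigidity 4796`. [folklore] -/
theorem uniformCoarseCappedRigidity_holds : UniformCoarseCappedRigidity 4796 := fun _ hθ0 hθ1 => coarseCappedRigidity_holds hθ0 hθ1

/-- **M from the basin certificate ALONE**: `BasinCertificate 4796 θ η → CappedRigidity θ η` (`0 < θ ≤ 1/100`). [folklore] -/
theorem cappedRigidity_of_basinCertificate {θ η : ℝ} (hθ0 : 0 < θ) (hθ1 : θ ≤ 1 / 100) (hL : BasinCertificate 4796 θ η) :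
    CappedRigidity θ η :=
  cappedRigidity_of_coarse_of_basin (coarseCappedRigidity_holds hθ0 hθ1) hL

/-- **Crux of item 27623 BY NAME from `MuEquilibriumDoor ∧ ChargedEnergyGap ∧ G(1/100) ∧ P(1/100) ∧ BasinCertificate 4796 (1/100) (1/20)`**
(R discharged). [folklore] -/
theorem aperiodicFrustratedLawGap_of_basinCertificate
    (hDoor : Summit.AtomisticToContinuum.Crystallization.Theses.GrainCoreNetworkSplit.MuEquilibriumDoor)
    (hgap : Summit.AtomisticToContinuum.Crystallization.Theses.PricedLinkCensus.ChargedEnergyGap)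
    (hG : LinkClassification (1 / 100)) (hP : CapForcing (1 / 100)) (hL : BasinCertificate 4796 (1 / 100) (1 / 20)) :
    Summit.AtomisticToContinuum.Crystallization.Theses.FrustratedLawDichotomy.AperiodicFrustratedLawGap :=
  aperiodicFrustratedLawGap_of_frameAssembly_of_basin le_rfl hDoor hgap hG hP frameAssemblyAt_fcc frameAssemblyAt_hcp hL

/-- **Item 26654 `NoFrustratedPeriodicMinimiser`, door-free, from `ChargedEnergyGap ∧ G ∧ P ∧ BasinCertificate 4796 (1/100) (1/20)`.**
[folklore] -/
theorem noFrustratedPeriodicMinimiser_of_basinCertificate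
    (hgap : Summit.AtomisticToContinuum.Crystallization.Theses.PricedLinkCensus.ChargedEnergyGap)
    (hG : LinkClassification (1 / 100)) (hP : CapForcing (1 / 100)) (hL : BasinCertificate 4796 (1 / 100) (1 / 20)) :
    Summit.AtomisticToContinuum.Crystallization.Theses.PeriodicChargeSplit.NoFrustratedPeriodicMinimiser :=
  noFrustratedPeriodicMinimiser_of_frameAssembly_of_basin le_rfl hgap hG hP frameAssemblyAt_fcc frameAssemblyAt_hcp hL

/-- **THE DIAL, certificate-free**: for `0 < θ < 1/95920`, `MuEquilibriumDoor ∧ PriceTol θ ∧ G θ ∧ P θ ⟹ AperiodicFrustratedLawGap`.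
[folklore] -/
theorem aperiodicFrustratedLawGap_dial {θ : ℝ} (hθ0 : 0 < θ) (hθ : θ < 1 / 95920)
    (hDoor : Summit.AtomisticToContinuum.Crystallization.Theses.GrainCoreNetworkSplit.MuEquilibriumDoor) (hprice : PriceTol θ)
    (hG : LinkClassification θ) (hP : CapForcing θ) :
    Summit.AtomisticToContinuum.Crystallization.Theses.FrustratedLawDichotomy.AperiodicFrustratedLawGap :=
  aperiodicFrustratedLawGap_of_price_of_frameAssembly le_rfl hθ0 (by linarith) (by linarith) hDoor hprice hG hP
    frameAssemblyAt_fcc frameAssemblyAt_hcp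

/-- **The dial, door-free sibling (item 26654)**: for `0 < θ < 1/95920`, `PriceTol θ ∧ G θ ∧ P θ ⟹ NoFrustratedPeriodicMinimiser`. [folklore] -/
theorem noFrustratedPeriodicMinimiser_dial {θ : ℝ} (hθ0 : 0 < θ) (hθ : θ < 1 / 95920) (hprice : PriceTol θ)
    (hG : LinkClassification θ) (hP : CapForcing θ) :
    Summit.AtomisticToContinuum.Crystallization.Theses.PeriodicChargeSplit.NoFrustratedPeriodicMinimiser :=
  noFrustratedPeriodicMinimiser_of_price_of_frameAssembly le_rfl hθ0 (by linarith) (by linarith) hprice hG hP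
    frameAssemblyAt_fcc frameAssemblyAt_hcp

end Summit.AtomisticToContinuum.Crystallization.Theorems.FrustratedLawDichotomyTwoShellRigidityCoarse

end
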